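import Summits.QuantumFields.YangMills.Theorems.EguchiKawaiDirectionLadderPlaquetteStrongCoupling
import HarnessLib

/-!
# The reduced plaquette of the (`U(N)`) Eguchi–Kawai model at strong coupling: `N`-uniform `O(b)` bound
# and the large-`N` statement

HONEST FRAMING. Glue for LINE 8 (`route-QuantumFields-EguchiKawaiDirectionLadder`, barrier-ledger line
onto `Literature.Barriers.QuantumFields.EguchiKawaiBreakdown`), rounding off the plaquette loop-equation
lane (`ek_plaquette_loopEquation`, `ek_plaquette_abs_le`):

* `ek_plaquette_abs_le_unitary` : the bound of `ek_plaquette_abs_le` transferred from the `SU(N)` model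
  to the `U(N)` model of the barrier entry (`ekExpectation`, Makeenko (14.43)) by phase invariance
  (`ekExpectation_eq_ekExpectationSU`): for `N ≥ 2`, `μ ≠ ν`, `8|b|(d-1) < 1`,
  `|⟨(1/N) Re tr(U_νᴴ U_μᴴ U_ν U_μ)⟩_EK| ≤ 4/(N²(1 - 8|b|(d-1))) + (3/2) d² |b|`;
* `ek_plaquette_eventually_abs_le` : hence for every `ε > 0`, for all large `N`,
  `|⟨(1/N) Re tr(U_νᴴ U_μᴴ U_ν U_μ)⟩_EK| ≤ (3/2) d² |b| + ε` — at strong coupling the reduced plaquette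
  is `O(b)` at `N = ∞`, the reduced-model counterpart of the leading strong-coupling behaviour of the
  lattice plaquette (Makeenko §14.3, (14.44)).

Nothing here concerns the Yang–Mills mass gap / the summit Statement `YangMills`.

References: Y. Makeenko, *Methods of Contemporary Gauge Theory* (2023) §14.3 (14.43)–(14.45), Problem 14.2.
-/

noncomputable section

open scoped Matrix ComplexConjugate BigOperators Topology
open Matrix Complex Finset MeasureTheory Filter
open Literature.Barriers.QuantumFields (EKConfig EKConfigSU ekHaarSU inclSU ekWeight ekPlaqTrace
  ekExpectation ekExpectationSU ekExpectation_eq_ekExpectationSU isPhaseInvariant_ekPlaqTrace continuous_ekPlaqTrace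
  IsPhaseInvariant)

namespace Summit.QuantumFields.YangMills.Theorems.EguchiKawaiDirectionLadder

variable {d N : ℕ}

/-- The normalised reduced plaquette `(1/N) Re tr(U_νᴴ U_μᴴ U_ν U_μ)` is a phase-invariant (centre
`U(1)^d`-invariant) observable. -/
theorem isPhaseInvariant_rePlaq (μ ν : Fin d) :
    IsPhaseInvariant fun U : EKConfig d N => (ekPlaqTrace U μ ν).re / N :=
  (isPhaseInvariant_ekPlaqTrace μ ν).comp fun z : ℂ => z.re / N

/-- **The `U(N)` and `SU(N)` single-site models have the same plaquette expectation** (phase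
invariance of the reduced plaquette; numerator and partition function transfer separately). -/
theorem ekExpectation_rePlaq_eq (b : ℝ) (μ ν : Fin d) :
    ekExpectation N b (fun U : EKConfig d N => (ekPlaqTrace U μ ν).re / N) =
      ekExpectationSU N b (fun V : EKConfigSU d N => (ekPlaqTrace (inclSU V) μ ν).re / N) :=
  ekExpectation_eq_ekExpectationSU b _
    ((Complex.continuous_re.comp (continuous_ekPlaqTrace μ ν)).div_const _).measurable
    (isPhaseInvariant_rePlaq μ ν)

/-- **The reduced plaquette of the Eguchi–Kawai model (`U(N)` links, Makeenko (14.40)–(14.43)) at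
strong coupling, uniformly in `N`**: for `N ≥ 2`, `μ ≠ ν` and `8|b|(d-1) < 1`,
`|⟨(1/N) Re tr(U_νᴴ U_μᴴ U_ν U_μ)⟩_EK| ≤ 4/(N²(1 - 8|b|(d-1))) + (3/2) d² |b|`. -/
theorem ek_plaquette_abs_le_unitary (hN : 2 ≤ N) {μ ν : Fin d} (hμν : μ ≠ ν) {b : ℝ}
    (hb : 8 * |b| * ((d : ℝ) - 1) < 1) :
    |ekExpectation N b (fun U : EKConfig d N => (ekPlaqTrace U μ ν).re / N)| ≤
      4 / ((N : ℝ) ^ 2 * (1 - 8 * |b| * ((d : ℝ) - 1))) + 3 / 2 * (d : ℝ) ^ 2 * |b| := by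
  rw [ekExpectation_rePlaq_eq]
  exact ek_plaquette_abs_le hN hμν hb

/-- **Large-`N` form**: at strong coupling (`8|b|(d-1) < 1`) the reduced plaquette expectation is `O(b)` at
`N = ∞` — for every `ε > 0` and all sufficiently large `N`,
`|⟨(1/N) Re tr(U_νᴴ U_μᴴ U_ν U_μ)⟩_EK| ≤ (3/2) d² |b| + ε`. -/
theorem ek_plaquette_eventually_abs_le {μ ν : Fin d} (hμν : μ ≠ ν) {b : ℝ}
    (hb : 8 * |b| * ((d : ℝ) - 1) < 1) {ε : ℝ} (hε : 0 < ε) :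
    ∀ᶠ N : ℕ in atTop,
      |ekExpectation N b (fun U : EKConfig d N => (ekPlaqTrace U μ ν).re / N)| ≤ 3 / 2 * (d : ℝ) ^ 2 * |b| + ε := by
  have hc : 0 < 1 - 8 * |b| * ((d : ℝ) - 1) := by linarith
  -- the `O(1/N²)` term tends to zero
  have hlim : Tendsto (fun N : ℕ => 4 / ((N : ℝ) ^ 2 * (1 - 8 * |b| * ((d : ℝ) - 1)))) atTop (𝓝 0) := by
    have h1 : Tendsto (fun N : ℕ => (N : ℝ) ^ 2 * (1 - 8 * |b| * ((d : ℝ) - 1))) atTop atTop :=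
      ((tendsto_pow_atTop two_ne_zero).comp tendsto_natCast_atTop_atTop).atTop_mul_const hc
    exact tendsto_const_nhds.div_atTop h1
  have hsmall : ∀ᶠ N : ℕ in atTop, 4 / ((N : ℝ) ^ 2 * (1 - 8 * |b| * ((d : ℝ) - 1))) ≤ ε := by
    have := (hlim.eventually (gt_mem_nhds hε))
    exact this.mono fun N hN => hN.le
  filter_upwards [hsmall, eventually_ge_atTop 2] with N hN h2
  exact (ek_plaquette_abs_le_unitary h2 hμν hb).trans (by linarith)

end Summit.QuantumFields.YangMills.Theorems.EguchiKawaiDirectionLadder
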